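import Literature.Algebra.EuclideanLattices.MRGapCVPEstimates
import Literature.Probability.Moments.HoeffdingMeanBounds
import Literature.Probability.Moments.RandomMatrixLargestEigenvalue
import HarnessLib

/-!
# Micciancio–Regev 2007, proof of Thm. 5.23 (`GapCVP′ → SIS′`): the verifier accepts a random witness — proved

Topic `Algebra/EuclideanLattices` (family `pqc`); serves the decomposition of the named fact
`Literature.Computability.Cryptography.MicciancioRegev2007_gapCVP'_to_SIS'` (MR07 Thm. 5.23 proper,
`GapSVPToSIS.lean`), assembling two probabilistic bricks of the tree written for it.

In the NO case of the reduction (authors' version pp. 29–31) the verifier `V(B, t, d, W)` of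
Aharonov–Regev is run on `N` witness vectors `w₁, …, w_N ∈ L(B)*`, "distributed independently
according to the distribution `D`" (p. 30), and the reduction answers correctly iff `V` accepts, i.e.
iff test (b) `f_W(t) = N⁻¹ ∑ᵢ cos(2π⟨t, wᵢ⟩) < 1/2` and test (c) "the largest eigenvalue of `W Wᵀ` is
at most `N/(2πd)²`" — in the quadratic-form reading `∑ᵢ ⟨x, wᵢ⟩² ≤ N‖x‖²/(2πd)²` for all `x` used by
the proof and by the tree's soundness theorem
`Literature.Algebra.EuclideanLattices.half_le_sum_cos_div_card_of_norm_sub_le` — both hold (test (a),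
membership in `L(B)*`, "is always satisfied", p. 30). The printed argument bounds the failure
probability of (b) by Hoeffding's inequality from the per-sample bound (16)
`E cos(2π⟨t, wᵢ⟩) ≤ 2⁻ⁿ⁺¹`, and that of (c) by Lemma 5.20 from the per-sample bounds (17), (18) with
`ℓ = 2sβ`, using `3Nℓ² = 12Ns²β² < N/(2πd)²` (p. 30). This file proves exactly this union bound:

* `MicciancioRegev2007.measureReal_verifier_reject_le` — for independent square-integrable random
  vectors `wᵢ` (`i ∈ ι`, `N = #ι`) in a real inner product space of dimension `n` with
  `E cos(2π⟨t, wᵢ⟩) ≤ μ ≤ 1/2`, `E⟨u, wᵢ⟩² ≤ ℓ²` for unit `u`, `Pr[‖wᵢ‖ ≥ Kℓ] ≤ σ`, and a threshold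
  `θ` with `3ℓ² ≤ θ`: `Pr[¬(f_W(t) < 1/2 ∧ ∀ x, ∑ᵢ ⟨x, wᵢ⟩² ≤ Nθ‖x‖²)] ≤
  e^{-N(1/2-μ)²/2} + e^{-N/K⁴}(4√n K²)ⁿ + Nσ` (tree: Hoeffding form
  `Literature.Probability.Moments.MicciancioRegev2007.measureReal_half_le_sum_cos_div_le`, Lemma 5.20
  `Literature.Probability.Moments.MicciancioRegev2007.measureReal_exists_lt_sum_inner_sq_le`).
  Identical distribution of the `wᵢ` is not needed.
* `MicciancioRegev2007.measureReal_verifier_reject_le_mr` — the same with the printed parameters: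
  `γ = 14π√n β`, `s = 2√n/(γd)`, `ℓ = 2sβ`, threshold `θ = 1/(2πd)²` of test (c)
  (`3ℓ² = 12s²β² < 1/(2πd)²`, tree: `MicciancioRegev2007.twelve_mul_sq_lt`), and `μ = 2 · 2⁻ⁿ`
  (eq. (16); `μ ≤ 1/2` for `n ≥ 2`).

The per-sample hypotheses are supplied, for the conditional witness law, by `MRGapCVPWitness.lean`
(eqs. (16)–(18)); the YES case (soundness of `V`) is `MRVerifierSoundness.lean`. Theorems only.

## References

* D. Micciancio, O. Regev, *Worst-case to average-case reductions based on Gaussian measures*,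
  SIAM J. Comput. 37 (2007) 267–302; authors' version (`lit read doi:10.1137/S0097539705447360`),
  proof of Thm. 5.23, pp. 29–30 (tests (b), (c); eq. (14), Lemma 5.20, eq. (16)).
* D. Aharonov, O. Regev, *Lattice problems in NP ∩ coNP*, J. ACM 52 (2005) 749–765, §6.
-/

noncomputable section

open MeasureTheory ProbabilityTheory Module Finset
open scoped Real InnerProductSpace

namespace Literature.Algebra.EuclideanLattices

namespace MicciancioRegev2007

variable {V : Type*} [NormedAddCommGroup V] [InnerProductSpace ℝ V] [FiniteDimensional ℝ V]
  [MeasurableSpace V] [BorelSpace V]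
variable {Ω : Type*} [MeasurableSpace Ω] {P : Measure Ω} [IsProbabilityMeasure P]
variable {ι : Type*} [Fintype ι]

/-- **The verifier of MR07 Thm. 5.23 accepts `N` independent good samples** (pp. 29–30): let
`wᵢ : Ω → V` (`i ∈ ι`, `N = #ι`, `n = dim V`) be independent square-integrable random vectors with
`E cos(2π⟨t, wᵢ⟩) ≤ μ ≤ 1/2` (eq. (16)), `E⟨u, wᵢ⟩² ≤ ℓ²` for all unit `u` (eq. (18)) and
`Pr[‖wᵢ‖ ≥ Kℓ] ≤ σ` (eq. (17)), and let `θ ≥ 3ℓ²` (p. 30: `3Nℓ² < N/(2πd)²`). Then the probability that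
test (b) `N⁻¹∑ᵢ cos(2π⟨t, wᵢ⟩) < 1/2` or test (c) `∀ x, ∑ᵢ ⟨x, wᵢ⟩² ≤ Nθ‖x‖²` fails is at most
`e^{-N(1/2-μ)²/2} + e^{-N/K⁴}(4√n K²)ⁿ + Nσ` — Hoeffding (14) for (b), Lemma 5.20 for (c), union bound
(stated for the outer measure `P.real`; no measurability of the events is needed).
[cite: MicciancioRegev2007, Thm. 5.23 (proof, pp. 29–30)] -/
theorem measureReal_verifier_reject_le {w : ι → Ω → V} (hind : iIndepFun w P)
    (hL2 : ∀ i, MemLp (w i) 2 P) (t : V) {μ ℓ K σ θ : ℝ}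
    (hμ : ∀ i, ∫ ω, Real.cos (2 * π * ⟪t, w i ω⟫_ℝ) ∂P ≤ μ) (hμhalf : μ ≤ 1 / 2)
    (hℓ : 0 < ℓ) (hK : 0 < K)
    (h2 : ∀ i (u : V), ‖u‖ = 1 → ∫ ω, ⟪u, w i ω⟫_ℝ ^ 2 ∂P ≤ ℓ ^ 2)
    (htail : ∀ i, P.real {ω | K * ℓ ≤ ‖w i ω‖} ≤ σ) (hθ : 3 * ℓ ^ 2 ≤ θ) :
    P.real {ω | ¬ ((∑ i, Real.cos (2 * π * ⟪t, w i ω⟫_ℝ)) / Fintype.card ι < 1 / 2 ∧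
        ∀ x : V, ∑ i, ⟪x, w i ω⟫_ℝ ^ 2 ≤ Fintype.card ι * θ * ‖x‖ ^ 2)} ≤
      Real.exp (-(Fintype.card ι * (1 / 2 - μ) ^ 2 / 2)) +
        (Real.exp (-(Fintype.card ι / K ^ 4)) * (4 * Real.sqrt (finrank ℝ V) * K ^ 2) ^ finrank ℝ V +
          Fintype.card ι * σ) := by
  set badB : Set Ω :=
    {ω | 1 / 2 ≤ (∑ i, Real.cos (2 * π * ⟪t, w i ω⟫_ℝ)) / Fintype.card ι} with hbadB
  set badC : Set Ω :=
    {ω | ∃ u : V, 3 * Fintype.card ι * ℓ ^ 2 * ‖u‖ ^ 2 < ∑ i, ⟪u, w i ω⟫_ℝ ^ 2} with hbadC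
  have hsub : {ω | ¬ ((∑ i, Real.cos (2 * π * ⟪t, w i ω⟫_ℝ)) / Fintype.card ι < 1 / 2 ∧
      ∀ x : V, ∑ i, ⟪x, w i ω⟫_ℝ ^ 2 ≤ Fintype.card ι * θ * ‖x‖ ^ 2)} ⊆ badB ∪ badC := by
    intro ω hω
    simp only [Set.mem_setOf_eq, not_and_or, not_lt, not_forall, not_le] at hω
    rcases hω with hb | ⟨x, hx⟩
    · exact Or.inl hb
    · refine Or.inr ⟨x, lt_of_le_of_lt ?_ hx⟩
      have hx2 : 0 ≤ (Fintype.card ι : ℝ) * ‖x‖ ^ 2 := by positivity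
      nlinarith
  have hB : P.real badB ≤ Real.exp (-(Fintype.card ι * (1 / 2 - μ) ^ 2 / 2)) :=
    Literature.Probability.Moments.MicciancioRegev2007.measureReal_half_le_sum_cos_div_le hind
      (fun i => (hL2 i).1.aemeasurable) t hμ hμhalf
  have hC : P.real badC ≤
      Real.exp (-(Fintype.card ι / K ^ 4)) * (4 * Real.sqrt (finrank ℝ V) * K ^ 2) ^ finrank ℝ V +
        Fintype.card ι * σ :=
    Literature.Probability.Moments.MicciancioRegev2007.measureReal_exists_lt_sum_inner_sq_le hind hL2
      hℓ hK h2 htail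
  calc P.real _ ≤ P.real (badB ∪ badC) := measureReal_mono hsub
    _ ≤ P.real badB + P.real badC := measureReal_union_le _ _
    _ ≤ _ := add_le_add hB hC

/-- **The verifier of MR07 Thm. 5.23 accepts, printed parameters** (pp. 29–30): with `n = dim V ≥ 2`,
`β, d > 0`, `γ = 14π√n β`, `s = 2√n/(γd)`, `ℓ = 2sβ` and `N` independent square-integrable samples
`wᵢ` satisfying eq. (16) `E cos(2π⟨t, wᵢ⟩) ≤ 2 · 2⁻ⁿ`, eq. (18) `E⟨u, wᵢ⟩² ≤ (2sβ)²` (unit `u`) and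
eq. (17) `Pr[‖wᵢ‖ ≥ K · 2sβ] ≤ σ`, the probability that `V` rejects — test (b) `f_W(t) < 1/2` fails or
test (c) `∑ᵢ ⟨x, wᵢ⟩² ≤ N‖x‖²/(2πd)²` for all `x` fails — is at most
`e^{-N(1/2 - 2·2⁻ⁿ)²/2} + e^{-N/K⁴}(4√n K²)ⁿ + Nσ`; the threshold step is `3ℓ² = 12s²β² < 1/(2πd)²`
(`MicciancioRegev2007.twelve_mul_sq_lt`). In print `K = √(nm)`, `N = n³m³`,
`σ = N2⁻ⁿ(1+ε)/(1-ε)`, and the Hoeffding exponent is the weaker `/4`.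
[cite: MicciancioRegev2007, Thm. 5.23 (proof, pp. 29–30)] -/
theorem measureReal_verifier_reject_le_mr {w : ι → Ω → V} (hind : iIndepFun w P)
    (hL2 : ∀ i, MemLp (w i) 2 P) (t : V) {β d K σ : ℝ} (hβ : 0 < β) (hd : 0 < d) (hK : 0 < K)
    (hn : 2 ≤ finrank ℝ V)
    (h16 : ∀ i, ∫ ω, Real.cos (2 * π * ⟪t, w i ω⟫_ℝ) ∂P ≤ 2 * (2⁻¹ : ℝ) ^ finrank ℝ V)
    (h18 : ∀ i (u : V), ‖u‖ = 1 → ∫ ω, ⟪u, w i ω⟫_ℝ ^ 2 ∂P ≤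
      (2 * (2 * Real.sqrt (finrank ℝ V) / (14 * π * Real.sqrt (finrank ℝ V) * β * d)) * β) ^ 2)
    (h17 : ∀ i, P.real {ω | K *
      (2 * (2 * Real.sqrt (finrank ℝ V) / (14 * π * Real.sqrt (finrank ℝ V) * β * d)) * β) ≤
        ‖w i ω‖} ≤ σ) :
    P.real {ω | ¬ ((∑ i, Real.cos (2 * π * ⟪t, w i ω⟫_ℝ)) / Fintype.card ι < 1 / 2 ∧
        ∀ x : V, ∑ i, ⟪x, w i ω⟫_ℝ ^ 2 ≤ Fintype.card ι * ‖x‖ ^ 2 / (2 * π * d) ^ 2)} ≤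
      Real.exp (-(Fintype.card ι * (1 / 2 - 2 * (2⁻¹ : ℝ) ^ finrank ℝ V) ^ 2 / 2)) +
        (Real.exp (-(Fintype.card ι / K ^ 4)) * (4 * Real.sqrt (finrank ℝ V) * K ^ 2) ^ finrank ℝ V +
          Fintype.card ι * σ) := by
  set s : ℝ := 2 * Real.sqrt (finrank ℝ V) / (14 * π * Real.sqrt (finrank ℝ V) * β * d) with hs
  have hn1 : 1 ≤ finrank ℝ V := by omega
  have hsq : 0 < Real.sqrt (finrank ℝ V) := Real.sqrt_pos.2 (by exact_mod_cast hn1)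
  have hspos : 0 < s := by rw [hs]; positivity
  have hℓ : 0 < 2 * s * β := by positivity
  -- `μ = 2·2⁻ⁿ ≤ 1/2` for `n ≥ 2`
  have hμhalf : 2 * (2⁻¹ : ℝ) ^ finrank ℝ V ≤ 1 / 2 := by
    calc 2 * (2⁻¹ : ℝ) ^ finrank ℝ V ≤ 2 * (2⁻¹ : ℝ) ^ 2 :=
          mul_le_mul_of_nonneg_left (pow_le_pow_of_le_one (by norm_num) (by norm_num) hn) (by norm_num)
      _ = 1 / 2 := by norm_num
  -- the threshold: `3ℓ² = 12 s²β² < 1/(2πd)²`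
  have hθ : 3 * (2 * s * β) ^ 2 ≤ 1 / (2 * π * d) ^ 2 := by
    have h := twelve_mul_sq_lt hβ hd hn1
    rw [← hs] at h
    nlinarith
  have h := measureReal_verifier_reject_le hind hL2 t h16 hμhalf hℓ hK h18 h17 hθ
  -- rewrite the threshold `N · (1/(2πd)²) · ‖x‖²` as `N ‖x‖² / (2πd)²`
  have hset : {ω | ¬ ((∑ i, Real.cos (2 * π * ⟪t, w i ω⟫_ℝ)) / Fintype.card ι < 1 / 2 ∧
      ∀ x : V, ∑ i, ⟪x, w i ω⟫_ℝ ^ 2 ≤ Fintype.card ι * ‖x‖ ^ 2 / (2 * π * d) ^ 2)} =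
      {ω | ¬ ((∑ i, Real.cos (2 * π * ⟪t, w i ω⟫_ℝ)) / Fintype.card ι < 1 / 2 ∧
      ∀ x : V, ∑ i, ⟪x, w i ω⟫_ℝ ^ 2 ≤ Fintype.card ι * (1 / (2 * π * d) ^ 2) * ‖x‖ ^ 2)} := by
    ext ω
    simp only [Set.mem_setOf_eq]
    have : ∀ x : V, (Fintype.card ι : ℝ) * ‖x‖ ^ 2 / (2 * π * d) ^ 2 =
        Fintype.card ι * (1 / (2 * π * d) ^ 2) * ‖x‖ ^ 2 := fun x => by ring
    simp_rw [this]
  rw [hset]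
  exact h

end MicciancioRegev2007

end Literature.Algebra.EuclideanLattices

end
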